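import Summits.FinalStateConjecture.FinalStateConjecture.Theses.BartnikGapSettling
import Summits.FinalStateConjecture.FinalStateConjecture.Theorems.RobustClausewiseGenericityRadialEscape
import Summits.FinalStateConjecture.FinalStateConjecture.Theorems.PhotonSphereChannelsTameCensorshipOfRobustKernels
import Summits.FinalStateConjecture.FinalStateConjecture.Theorems.TameCensorshipCollarMargin.Negative.TameCensorshipCollarMarginFalseOfExtremalJunkCollars
import Literature.Geometry.Lorentzian.CauchyDevelopmentPrecomp
import Literature.Geometry.Lorentzian.TameGenericityDiagonal

/-!
# Line `kflux-seeds-the-ratchet` — CHECKED SKELETON for crux `TameCensorshipCollarMargin`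
# (stmt-FinalStateConjecture-17329, route `BartnikGapSettling`, rank 5): robust `∧`-decoupling of
# censorship from the collar third law, a collar census, and the K-flux seed on the Kehle–Unger stratum

planner-cruxplan-stmt-FinalStateConjecture-17329-kflux-seeds-the-ratc-0 (crux-plan, round 1), 2026-08-17.
Idea card `Cruxes/TameCensorshipCollarMargin/Ideas/kflux-seeds-the-ratchet.md` (triage r1-1/r1-2/r1-3: pass ×3,
"reach = KU stratum + the robust ∧-bookkeeping; type E1/FCE and E3/𝔐_stable as their own stubs; name the
census residual"). Line card: `Lines/kflux-seeds-the-ratchet.md`; this file is published as `Lines/kflux_seeds_the_ratchet.lean`. `lean check`: rc 0, sorries 5 = the five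
`stub_*` below, 0 elsewhere.

## STANDING PREMISE — which decl this skeleton concludes, and why

The FILED route decl `BartnikGapSettling.TameCensorshipCollarMargin` (route file rev 6, l.474: margin conjunct
UN-WINDOWED — labels `M₁` and boosts unbounded against one unweighted `Cᵏ` tolerance) is false modulo
`ExtremalJunkCollars ∧ MGHDExists` (LANDED negative lemma p146745,
`Theorems/TameCensorshipCollarMargin/Negative/…FalseOfExtremalJunkCollars.lean`; re-exported in §5), and EVERY
stub set whose composition reaches the filed clause on a junk-carrying development contains a false stub
(`VERDICT_lead0.lean` §1 `filedClause_false_of_junk`; line `birth` died at exactly that stub, `stub_unwindowing`).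
So no honest skeleton can conclude the filed text, and this file does not pretend to: its skeleton theorem
`TameCensorshipCollarMarginW_of` concludes BY NAME the RESTATED crux `TameCensorshipCollarMarginW` (§0; the
windowed order-2 clause C‴₂, byte-identical with `VERDICT_lead0.lean` §2 = the converged repair of four leads,
the refuter's ATTACK.md and all three triagers), and §5 records — with the dead transfer as an explicit
HYPOTHESIS, not a stub — how and only how the filed decl would follow. After the planner restates 17329, the
re-targeting is a one-token edit (`TameCensorshipCollarMarginW` ↦ the route decl) if the restated text is C‴₂;
if the restatement adds H4/H5a (future/visible slabs) only `stub_collarCensus` changes, and only by weakening.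

## The line

Tame genericity is not `∧`-closed (`Theorems/TameCensorship/Negative/GenericityAndFails.lean`), so the
crux is ONE generic statement for "censored ∧ windowed collar margin". `birth` paid this through the RELATIVE
kernel (third law ALONG censored curves — lever-less, ROUND2-k5 §4). This line pays it through the ROBUST
kernel, landed twice over: `RobustlyEscapable.and` (`Theorems/RobustClausewiseGenericityAssembly.lean`) and the
engine `isTameChristodoulouGeneric_of_robust` (`Theorems/PhotonSphereChannelsTameCensorshipOfRobustKernels.lean`:
robust `Q` at every admissible datum + gauge-invariant `P ⇐ Q` ⇒ `P` tame-generic, via `stub_pathOfRobust` /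
`stub_witnessOfGoodPath`, all landed). With `Q D :=` "every MGHD of `D` is censored ∧ every MGHD of `D` carries
NO future-going late chart modelled on a boosted EXTREMAL Kerr exterior whose truncated `C²` deviation on the
COLLAR ZONE `{r ≤ 3M+1}` tends to `0`" (hole-level, stand-off charts allowed — `IsLateChart` has no covering
condition, so hairy holes quiet only off the horizon ARE seen) and `P :=` the restated property:

* gauge invariance of `P` is PROVED here (`marginW_comap`, from the landed transfer principle
  `VacuumCauchyDevelopment.forall_isMaximal_comap_iff` + `hasCompleteFutureNullInfinity_precomp_iff`);
* `Q ⇒ P` per MGHD is the COLLAR CENSUS `stub_collarCensus` (collars ⇒ a hole: curvature floor, window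
  compactness, label rigidity `spin_ratio_lock`, eventual quietness) — the residual every horizon-side line
  owes, here a named stub (TRIAGE-r1-1 (c));
* robust `Q` = `stub_censorshipRobust` (= shared item `CensorshipRobust`, stmt-10131) `.and` robust freeness,
  and robust freeness at an admissible `d` is supplied by THREE mechanisms on an exhaustive case split:
  `stub_openAtGood` (good data: stability), `stub_kuSeed` (Kehle–Unger data: THE LEVER — the absorbed
  `K`-flux `q(v) = δ²M_𝓗 − Ω_H δ²J_𝓗 ≥ 0` is a positive quadratic form in the probe direction, so the bad
  directions of every enriched tame probe lie in finitely many PROPER LINEAR SUBSPACES; `robustlyEscapable_of_seeded`,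
  PROVED here, turns that certificate into robust escapability by linear algebra — the `κ = 0` counterpart of
  the landed `robustlyEscapable_of_walls`, whose `C¹` wall degenerates exactly where the first law becomes a
  tangency), and `stub_thresholdOffKU` (every other exceptional datum: E1 spin-up / frozen cavity — socket
  for `zdm-spinup-window`'s `FrozenCavityExclusion`; E3 / `𝔐_stable` first-order census-side transversal —
  UNCLAIMED by this lever, typed as demanded by TRIAGE-r1-2/3; uncensored base data; mixed data).

Registered stubs (5): `stub_censorshipRobust` (shared, open) · `stub_collarCensus` (L) · `stub_kuSeed` (L–XL,
the bet) · `stub_openAtGood` (L) · `stub_thresholdOffKU` (XL, hardest by scope). Composition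
`TameCensorshipCollarMarginW_of_stubs` / `TameCensorshipCollarMarginW_of`: sorry-free.

## Disproof used

No `Cruxes/TameCensorshipCollarMargin/Disproof.lean` exists (payload `disproof_path` absent on this hub;
`ledger crux ls` lists none — same finding as all three triagers and both leads). Honoured instead: (a) the
landed Negative lemma p146745 / `filedClause_false_of_junk` — by NOT concluding the filed decl (target = C‴₂:
label window `∀ m₀` and boost window BEFORE the tolerance, order 2; the junk family `M₁ → ∞` and micro-collars
`M₁ → 0` miss every window); (b) `stub_unwindowing_false_of_ExtremalJunkCollars` (VERDICT_lead0 §1) — the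
transfer appears only as hypothesis `hU` of §5, never as a stub; (c) `TameGenericityAndFails` — no conjunction of
curve-witnesses anywhere: `∧` is taken at the ROBUST level (`RobustlyEscapable.and`); (d) STAND-OFF COLLARS
(TRIAGE-r1-2 N1, the η-hover that killed `azimuthal-hair-is-loud-at-order-two`) — the hole-level notion is a
late chart WITHOUT covering condition and with COLLAR-ZONE truncation, so asymptotic extremality quiet only at
fixed `r > M` is detected, and no stub asks a horizon-layer phenomenon to vacate a collar; (e) `ledger negatives
--problem FinalStateConjecture`: 1 entry (stmt-10045, photon-sphere channels) — unrelated to all five stubs.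
-/

noncomputable section

-- D-0017: single-problem summit, `Summit.<S>.<S>.…` by design (cf. lakefile `weak.linter.dupNamespace`).
set_option linter.dupNamespace false
-- instance search through the nested operator type `E4 →L[ℝ] E4 →L[ℝ] ℝ` of metric components (as in the chart files)
set_option maxSynthPendingDepth 3

open Set Function Filter
open scoped Manifold ContDiff Topology

namespace Summit.FinalStateConjecture.FinalStateConjecture.Cruxes.TameCensorshipCollarMargin.KfluxSeedsTheRatchet

open Literature.Geometry.Lorentzian
open Summit.FinalStateConjecture.FinalStateConjecture.Theorems.RobustClausewiseGenericity
  (Tame RobustlyEscapable)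
open Summit.FinalStateConjecture.FinalStateConjecture.Theorems.PhotonSphereChannels.TameCensorshipUnwind
  (isTameChristodoulouGeneric_of_robust)

/-! ## §0 The target: the RESTATED crux C‴₂ (tame), verbatim `VERDICT_lead0.lean` §2 -/

/-- **Restated crux C‴₂ (tame) — `TameCensorshipCollarMargin` with the margin WINDOWED (label
`m₀ ≤ M₁ ≤ m₀⁻¹`, boost `max ‖Λ‖ ‖Λ⁻¹‖ ≤ ρ₀`, quantified BEFORE `(χ₁, δ₁, K₁)`) and at order `2`.**
Byte-identical with `Cruxes/TameCensorshipCollarMargin/VERDICT_lead0.lean`'s `TameCensorshipCollarMarginW`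
(= the inner clause of `Lines/birth.lean`'s `stub_windowedThirdLawAlongCensoredCurves`; the 10809/10808
leads' converged repair). THIS is the decl the line concludes; the filed decl is reached only in §5,
through the dead unwindowing transfer, for the record. -/
def TameCensorshipCollarMarginW : Prop :=
  ∀ (X : Type) [TopologicalSpace X] [ChartedSpace E3 X] [IsManifold (𝓡 3) ((⊤ : ℕ∞) : WithTop ℕ∞) X] [T2Space X] [SecondCountableTopology X] [ConnectedSpace X], InitialDataSet.IsTameChristodoulouGeneric (admissibleVacuumData X) (fun D => ∀ 𝒟 : VacuumCauchyDevelopment D, 𝒟.IsMaximal → Summit.FinalStateConjecture.HasCompleteNullInfinity 𝒟.toCauchyDevelopment ∧ (∀ m₀ ρ₀ : ℝ, 0 < m₀ → 0 < ρ₀ → ∃ (χ₁ : ℝ) (δ₁ : ENNReal) (K₁ : Set 𝒟.carrier), χ₁ < 1 ∧ 0 < δ₁ ∧ IsCompact K₁ ∧ ∀ (M₁ a₁ : ℝ) (mo₁ : lorentzGroup × E4) (B₁ : ModelBackground) (Φ₁ : B₁.domain → 𝒟.carrier), m₀ ≤ M₁ → M₁ ≤ m₀⁻¹ → max ‖((mo₁.1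 : E4 ≃L[ℝ] E4) : E4 →L[ℝ] E4)‖ ‖((mo₁.1 : E4 ≃L[ℝ] E4).symm : E4 →L[ℝ] E4)‖ ≤ ρ₀ → |a₁| ≤ M₁ → B₁ = starBackground mo₁.1 mo₁.2 M₁ a₁ (fun x => Kerr.radius a₁ (poincareInv mo₁.1 mo₁.2 x)) → ContMDiffOn 𝓘(ℝ, E4) (𝓡 4) ((⊤ : ℕ∞) : WithTop ℕ∞) Φ₁ {x | -1 < B₁.time x.1 ∧ B₁.time x.1 < 1 ∧ B₁.radius x.1 < 3 * M₁ + 1} → Topology.IsOpenEmbedding ({x | -1 < B₁.time x.1 ∧ B₁.time x.1 < 1 ∧ B₁.radius x.1 < 3 * M₁ + 1}.restrict Φ₁) → 𝒟.toSpacetime.truncDeviationCk B₁ Φ₁ 2 (3 * M₁) 0 ≤ δ₁ → Disjoint (Φ₁ '' B₁.truncTimeSlab (3 * M₁) 0) (𝒟.metric.causalPast 𝒟.timeOrientation K₁) → |a₁| ≤ χ₁ * M₁)) 1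

/-! ## §1 The stubs (registered obligations; the ONLY `sorry`s of the file) -/

/-- **Stub A — `stub_censorshipRobust`: ROBUST weak cosmic censorship** (shared verbatim-in-substance with
item `CensorshipRobust`, stmt-FinalStateConjecture-10131, routes `RobustClausewiseGenericity` /
`PhotonSphereChannels` K3): at every admissible datum `d` of `X`, the property "every MGHD has complete
`𝓘⁺` (sojourn form)" is ROBUSTLY ESCAPABLE (`Theorems.RobustClausewiseGenericity.RobustlyEscapable`: every
tame probe through `d` enriches, along an injective linear map of parameter spaces, to a tame probe along
all of whose further tame enrichments an open dense set of radial directions is good for all small non-zero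
parameters). Open problem (Christodoulou CQG 16 (1999) p. A24). NOT this line's burden: it is the
`∧`-decoupled censorship half, staffed once on the shared item. -/
theorem stub_censorshipRobust : ∀ (X : Type) [TopologicalSpace X] [ChartedSpace E3 X] [IsManifold (𝓡 3) ((⊤ : ℕ∞) : WithTop ℕ∞) X] [T2Space X] [SecondCountableTopology X] [ConnectedSpace X], ∀ d ∈ admissibleVacuumData X, RobustlyEscapable d (fun D : InitialDataSet (𝓡 3) X => (∀ 𝒟 : VacuumCauchyDevelopment D, 𝒟.IsMaximal → Summit.FinalStateConjecture.HasCompleteNullInfinity 𝒟.toCauchyDevelopment)) := by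
  sorry

/-- **Stub C — `stub_collarCensus`: THE COLLAR CENSUS / READ-OUT (collars ⇒ a hole).** In a censored MGHD of
an admissible datum: if NO future-going late chart modelled on a boosted EXTREMAL Kerr exterior
(`Kerr.IsExtremal M a`, `IsLateChart`, push-forward of the Kerr–Schild time vector eventually
future-directed on truncated slabs) has truncated `C²` deviation on its COLLAR ZONE `{r ≤ 3M + 1}` tending to
`0`, then the WINDOWED collar margin holds: for every window `(m₀, ρ₀)` some `χ₁ < 1`, `δ₁ > 0`, compact `K₁`
bound the label ratio of every windowed `δ₁`-quiet thick collar beyond `J⁻(K₁)`. Contrapositive = the census: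
a sequence of ever quieter windowed thick collars with labels `|a₁|/M₁ → 1` escaping every compact past
(i) cannot sit in the near-flat far field or near `𝓘⁺`/`i⁰` (curvature floor `≥ c(m₀) > 0` of a `C²`-quiet
windowed collar vs. exterior stability), (ii) cannot sit in the bounded past (inside `J⁻(K₁)`), hence
accumulates in the late future at bounded radius, where (iii) by compactness of the window the labels and
boosts subconverge to `(M, ±M, Λ)` and label rigidity of quiet collars (`spin_ratio_lock`, p123576) plus
EVENTUAL QUIETNESS organise them into ONE future-going late chart on `Kerr(M, ±M)` with collar-zone
deviation `→ 0` (stand-off charts allowed: `IsLateChart` has no covering condition). Size L. Why it might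
fail: eternally INTERMITTENT quietness (a hole repeatedly near-extremal-quiet and re-disturbed forever) or
drifting boosts/labels would give bad collar sequences with no converging chart — the `FiniteLateCensus`
residual every horizon-side line concedes (TRIAGE-r1-1 (c)); interior (`𝒟 ∖ J⁻(𝓘⁺)`) windowed collars are
charged here too unless the planner's restatement adds H5a (visible slabs), which only weakens this stub. -/
theorem stub_collarCensus : ∀ (X : Type) [TopologicalSpace X] [ChartedSpace E3 X] [IsManifold (𝓡 3) ((⊤ : ℕ∞) : WithTop ℕ∞) X] [T2Space X] [SecondCountableTopology X] [ConnectedSpace X], ∀ D ∈ admissibleVacuumData X, ∀ 𝒟 : VacuumCauchyDevelopment D, 𝒟.IsMaximal → Summit.FinalStateConjecture.HasCompleteNullInfinity 𝒟.toCauchyDevelopment → (∀ (Λ : lorentzGroup) (c : E4) (M a : ℝ), Kerr.IsExtremal M a → ¬ ∃ (τ₀ : ℝ) (Ψ : (boostedKerrBackground Λ c M a).domain → 𝒟.carrier), 𝒟.toSpacetime.IsLateChart (boostedKerrBackground Λ c M a) Set.univ τ₀ Ψ ∧ (∀ ρ : ℝ, ∀ᶠ τ in Filter.atTop, ∀ x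 ∈ (boostedKerrBackground Λ c M a).truncTimeSlab ρ τ, 𝒟.timeOrientation.IsFutureDirected (mfderiv 𝓘(ℝ, E4) (𝓡 4) Ψ x ((Λ : E4 ≃L[ℝ] E4) (Kerr.timeVector M a (poincareInv Λ c (x : E4)))))) ∧ Filter.Tendsto (fun τ => 𝒟.toSpacetime.truncDeviationCk (boostedKerrBackground Λ c M a) Ψ 2 (3 * M + 1) τ) Filter.atTop (nhds 0)) → (∀ m₀ ρ₀ : ℝ, 0 < m₀ → 0 < ρ₀ → ∃ (χ₁ : ℝ) (δ₁ : ENNReal) (K₁ : Set 𝒟.carrier), χ₁ < 1 ∧ 0 < δ₁ ∧ IsCompact K₁ ∧ ∀ (M₁ a₁ : ℝ) (mo₁ : lorentzGroup × E4) (B₁ : ModelBackground) (Φ₁ : B₁.domain → 𝒟.carrier), m₀ ≤ M₁ → M₁ ≤ m₀⁻¹ → max ‖((mo₁.1 : E4 ≃L[ℝ] E4) : E4 →L[ℝ] E4)‖ ‖((mo₁.1 : E4 ≃L[ℝ] E4).symm : E4 →L[ℝ] E4)‖ ≤ ρ₀ → |a₁| ≤ M₁ → B₁ = starBackground mo₁.1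 mo₁.2 M₁ a₁ (fun x => Kerr.radius a₁ (poincareInv mo₁.1 mo₁.2 x)) → ContMDiffOn 𝓘(ℝ, E4) (𝓡 4) ((⊤ : ℕ∞) : WithTop ℕ∞) Φ₁ {x | -1 < B₁.time x.1 ∧ B₁.time x.1 < 1 ∧ B₁.radius x.1 < 3 * M₁ + 1} → Topology.IsOpenEmbedding ({x | -1 < B₁.time x.1 ∧ B₁.time x.1 < 1 ∧ B₁.radius x.1 < 3 * M₁ + 1}.restrict Φ₁) → 𝒟.toSpacetime.truncDeviationCk B₁ Φ₁ 2 (3 * M₁) 0 ≤ δ₁ → Disjoint (Φ₁ '' B₁.truncTimeSlab (3 * M₁) 0) (𝒟.metric.causalPast 𝒟.timeOrientation K₁) → |a₁| ≤ χ₁ * M₁) := by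
  sorry

/-- **Stub D — `stub_kuSeed`: THE K-FLUX SEED ON THE KEHLE–UNGER STRATUM (the lever; load-bearing for the
reach this line claims).** Let `d` be admissible with a censored MGHD carrying a future-going late chart on
a boosted EXTREMAL Kerr exterior that is eventually EXACT on every truncated slab (the DOC is isometric to
extremal Kerr near the hole after finite time: Kehle–Unger arXiv:2211.15742 Cor. 1 / the vacuum conjecture
of arXiv:2402.10190 p. 7 — the only printed formation mechanism of extremal horizons). Then `d` is SEEDED for
the property "no future-going asymptotically-extremal collar-zone late chart in any MGHD": every tame probe
`G` through `d` enriches to a tame `G₁` (add one FEEDING direction `w`, supported in a far annulus, with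
positive absorbed `K`-energy `q(w) > 0` through a late window of the extremal horizon — `K = T + Ω_H Φ`,
horizon flux per mode `∝ (ω − mΩ_H)² ≥ 0`, Teukolsky–Press 1974 / Hollands–Wald arXiv:1201.0463 Thm 1;
non-vanishing transmission: TP coefficients real-analytic in `ω`, not identically zero), such that along
EVERY further tame enrichment `G₂ : ℝᵖ → data` the bad directions lie in FINITELY MANY PROPER LINEAR
SUBSPACES `V₁ … V_J` of `ℝᵖ`: off `⋃ Vⱼ` the member `G₂ (t • v)` has, for all small `t ≠ 0`, no
asymptotically extremal hole. Mechanism: at zero temperature the first law is a tangency and the seed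
`δ²(M² − |J|) = 2M·q(v) ≥ 0` is a POSITIVE QUADRATIC FORM in `v`, so its bad set is its KERNEL (a subspace,
proper once `w` is in); first-order cross seeds `ℓ(v)` at corner directions add `ker ℓ`; one subspace per
exactly-extremal hole. The NONLINEAR half (honest hard part, `SlowlyRotatingKerrFrontier` NOT evaded): a
member seeded with deficit `≍ q(v)t²` at a finite advanced time and `O(t²)` residual influx stays and settles
SUB-extremal (near-extremal forward stability in the regime of Angelopoulos–Kehle–Unger arXiv:2410.16234
Thm 1 / Dafermos GRG 57 (2025) Conj. 6.1), sheds the inherited horizon charges by its own red-shift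
`κ(t) ≍ |t|√q`, and develops no OTHER asymptotically extremal hole (Cauchy stability of `d`'s remaining,
non-extremal, structures). Size L–XL. Why it might fail: a member parked at `κ = 0` by a frozen cavity of
its own ringing (then `stub_thresholdOffKU`'s FCE is needed even here); infinitely many exactly-extremal
holes in one datum (countable union of kernels, complement not open). -/
theorem stub_kuSeed : ∀ (X : Type) [TopologicalSpace X] [ChartedSpace E3 X] [IsManifold (𝓡 3) ((⊤ : ℕ∞) : WithTop ℕ∞) X] [T2Space X] [SecondCountableTopology X] [ConnectedSpace X], ∀ d ∈ admissibleVacuumData X, (∃ 𝒟 : VacuumCauchyDevelopment d, 𝒟.IsMaximal ∧ Summit.FinalStateConjecture.HasCompleteNullInfinity 𝒟.toCauchyDevelopment ∧ ∃ (Λ : lorentzGroup) (c : E4) (M a : ℝ) (τ₀ : ℝ) (Ψ : (boostedKerrBackground Λ c M a).domain → 𝒟.carrier), Kerr.IsExtremal M a ∧ 𝒟.toSpacetime.IsLateChart (boostedKerrBackground Λ c M a) Set.univ τ₀ Ψ ∧ (∀ ρ : ℝ, ∀ᶠ τ in Filter.atTop, ∀ x ∈ (boostedKerrBackground Λ c M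 a).truncTimeSlab ρ τ, 𝒟.timeOrientation.IsFutureDirected (mfderiv 𝓘(ℝ, E4) (𝓡 4) Ψ x ((Λ : E4 ≃L[ℝ] E4) (Kerr.timeVector M a (poincareInv Λ c (x : E4)))))) ∧ ∀ R : ℝ, ∀ᶠ τ in Filter.atTop, 𝒟.toSpacetime.truncDeviationCk (boostedKerrBackground Λ c M a) Ψ 2 R τ = 0) → ∀ (m : ℕ) (G : EuclideanSpace ℝ (Fin m) → InitialDataSet (𝓡 3) X), Tame d m G → ∃ (n : ℕ) (G₁ : EuclideanSpace ℝ (Fin n) → InitialDataSet (𝓡 3) X) (L : EuclideanSpace ℝ (Fin m) →ₗ[ℝ] EuclideanSpace ℝ (Fin n)), Function.Injective L ∧ Tame d n G₁ ∧ (∀ c, G₁ (L c) = G c) ∧ ∀ (p : ℕ) (G₂ : EuclideanSpace ℝ (Fin p) → InitialDataSet (𝓡 3) X) (L' : EuclideanSpace ℝ (Fin n) →ₗ[ℝ] EuclideanSpace ℝ (Fin p)), Function.Injective L' → Tame d p G₂ → (∀ c, G₂ (L' c) = G₁ c) → ∃ (J : ℕ) (V : Fin J → Submodule ℝ (EuclideanSpace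 ℝ (Fin p))), (∀ j, V j ≠ ⊤) ∧ ∀ v : EuclideanSpace ℝ (Fin p), (∀ j, v ∉ V j) → ∃ δ : ℝ, 0 < δ ∧ ∀ t : ℝ, t ≠ 0 → |t| < δ → (∀ 𝒟 : VacuumCauchyDevelopment (G₂ (t • v)), 𝒟.IsMaximal → (∀ (Λ : lorentzGroup) (c : E4) (M a : ℝ), Kerr.IsExtremal M a → ¬ ∃ (τ₀ : ℝ) (Ψ : (boostedKerrBackground Λ c M a).domain → 𝒟.carrier), 𝒟.toSpacetime.IsLateChart (boostedKerrBackground Λ c M a) Set.univ τ₀ Ψ ∧ (∀ ρ : ℝ, ∀ᶠ τ in Filter.atTop, ∀ x ∈ (boostedKerrBackground Λ c M a).truncTimeSlab ρ τ, 𝒟.timeOrientation.IsFutureDirected (mfderiv 𝓘(ℝ, E4) (𝓡 4) Ψ x ((Λ : E4 ≃L[ℝ] E4) (Kerr.timeVector M a (poincareInv Λ c (x : E4)))))) ∧ Filter.Tendsto (fun τ => 𝒟.toSpacetime.truncDeviationCk (boostedKerrBackground Λ c M a) Ψ 2 (3 * M + 1) τ) Filter.atTop (nhds 0))) := by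
  sorry

/-- **Stub E_good — `stub_openAtGood`: ROBUSTNESS AT GOOD DATA IS STABILITY.** At an admissible datum all of
whose MGHDs are censored and free of future-going asymptotically-extremal collar-zone late charts, that
freeness is robustly escapable — i.e. (openness would suffice) small tame perturbations of a datum whose
holes end strictly sub-extremal, or which disperses, do not create an asymptotically extremal hole, off a
closed nowhere-dense set of directions. Cauchy stability on compact domains + asymptotic stability of
sub-extremal Kerr exteriors (Klainerman–Szeftel / Giorgi–Klainerman–Szeftel for `|a| ≪ M`; conjectural in
the full range) + stability of Minkowski. Size L. Why it might fail: a good datum on the verge of forming an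
ADDITIONAL hole that would be extremal (then genericity, not openness, is what holds — still fine for the
robust form, but the proof is threshold analysis again); sub-extremal Kerr stability is open beyond
`|a| ≪ M` (`Literature.Barriers.FinalStateConjecture.SlowlyRotatingKerrFrontier`). -/
theorem stub_openAtGood : ∀ (X : Type) [TopologicalSpace X] [ChartedSpace E3 X] [IsManifold (𝓡 3) ((⊤ : ℕ∞) : WithTop ℕ∞) X] [T2Space X] [SecondCountableTopology X] [ConnectedSpace X], ∀ d ∈ admissibleVacuumData X, (∀ 𝒟 : VacuumCauchyDevelopment d, 𝒟.IsMaximal → Summit.FinalStateConjecture.HasCompleteNullInfinity 𝒟.toCauchyDevelopment) → (∀ 𝒟 : VacuumCauchyDevelopment d, 𝒟.IsMaximal → (∀ (Λ : lorentzGroup) (c : E4) (M a : ℝ), Kerr.IsExtremal M a → ¬ ∃ (τ₀ : ℝ) (Ψ : (boostedKerrBackground Λ c M a).domain → 𝒟.carrier), 𝒟.toSpacetime.IsLateChart (boostedKerrBackground Λ c M a) Set.univ τ₀ Ψ ∧ (∀ ρ : ℝ, ∀ᶠ τ in Filter.atTop, ∀ x ∈ (boostedKerrBackground Λ c M a).truncTimeSlab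 ρ τ, 𝒟.timeOrientation.IsFutureDirected (mfderiv 𝓘(ℝ, E4) (𝓡 4) Ψ x ((Λ : E4 ≃L[ℝ] E4) (Kerr.timeVector M a (poincareInv Λ c (x : E4)))))) ∧ Filter.Tendsto (fun τ => 𝒟.toSpacetime.truncDeviationCk (boostedKerrBackground Λ c M a) Ψ 2 (3 * M + 1) τ) Filter.atTop (nhds 0))) → RobustlyEscapable d (fun D : InitialDataSet (𝓡 3) X => (∀ 𝒟 : VacuumCauchyDevelopment D, 𝒟.IsMaximal → (∀ (Λ : lorentzGroup) (c : E4) (M a : ℝ), Kerr.IsExtremal M a → ¬ ∃ (τ₀ : ℝ) (Ψ : (boostedKerrBackground Λ c M a).domain → 𝒟.carrier), 𝒟.toSpacetime.IsLateChart (boostedKerrBackground Λ c M a) Set.univ τ₀ Ψ ∧ (∀ ρ : ℝ, ∀ᶠ τ in Filter.atTop, ∀ x ∈ (boostedKerrBackground Λ c M a).truncTimeSlab ρ τ, 𝒟.timeOrientation.IsFutureDirected (mfderiv 𝓘(ℝ, E4) (𝓡 4) Ψ x ((Λ : E4 ≃L[ℝ] E4) (Kerr.timeVector M a (poincareInv Λ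 c (x : E4)))))) ∧ Filter.Tendsto (fun τ => 𝒟.toSpacetime.truncDeviationCk (boostedKerrBackground Λ c M a) Ψ 2 (3 * M + 1) τ) Filter.atTop (nhds 0)))) := by
  sorry

/-- **Stub E_bad — `stub_thresholdOffKU`: THE THRESHOLD OFF THE KEHLE–UNGER STRATUM (UNCLAIMED by this line's
lever; named so that the other levers have a socket).** At an admissible datum which is exceptional (some
MGHD uncensored, or carrying a future-going asymptotically-extremal collar-zone late chart) but NOT of
Kehle–Unger type (no censored MGHD with an eventually EXACT future-going extremal late chart), the freeness
property is robustly escapable. By the sign of the calibrated running deficit `ε_J(v)` of the would-be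
extremal hole (TRIAGE-r1-2 N2) this covers: E1 — spin-up through the superradiant window with `ε_J ↓ 0`
(to be EMPTY by `FrozenCavityExclusion`, idea `zdm-spinup-window`, liminf form, `v₀` in the final
perturbative era); E3 / `𝔐_stable` — the area-deficient, tail-dominated approach of the generic threshold
datum between collapse-to-sub-extremal and dispersion (AKU arXiv:2410.16234 §1.3.1, Dafermos Conj. 6.2),
where the transversal is FIRST order and census-side (no late hole on one side): a `C¹` threshold
hypersurface in every tame enrichment gives the same "off a proper subspace" certificate with `J = 1`;
uncensored base data (naked-singularity formers: censored neighbours must not form extremal holes); mixed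
data (an exact KU hole next to an E1/E3 hole). Size XL (it is the generic third law of black-hole
mechanics off one stratum). Why it might fail: an OPEN nonlinear frozen-cavity basin (zdm's caricature has
one) would make the restated crux false on an open set; `𝔐_stable` need not be `C¹` in vacuum. -/
theorem stub_thresholdOffKU : ∀ (X : Type) [TopologicalSpace X] [ChartedSpace E3 X] [IsManifold (𝓡 3) ((⊤ : ℕ∞) : WithTop ℕ∞) X] [T2Space X] [SecondCountableTopology X] [ConnectedSpace X], ∀ d ∈ admissibleVacuumData X, ¬ (∃ 𝒟 : VacuumCauchyDevelopment d, 𝒟.IsMaximal ∧ Summit.FinalStateConjecture.HasCompleteNullInfinity 𝒟.toCauchyDevelopment ∧ ∃ (Λ : lorentzGroup) (c : E4) (M a : ℝ) (τ₀ : ℝ) (Ψ : (boostedKerrBackground Λ c M a).domain → 𝒟.carrier), Kerr.IsExtremal M a ∧ 𝒟.toSpacetime.IsLateChart (boostedKerrBackground Λ c M a) Set.univ τ₀ Ψ ∧ (∀ ρ : ℝ, ∀ᶠ τ in Filter.atTop, ∀ x ∈ (boostedKerrBackground Λ c M a).truncTimeSlab ρ τ, 𝒟.timeOrientation.IsFutureDirected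 (mfderiv 𝓘(ℝ, E4) (𝓡 4) Ψ x ((Λ : E4 ≃L[ℝ] E4) (Kerr.timeVector M a (poincareInv Λ c (x : E4)))))) ∧ ∀ R : ℝ, ∀ᶠ τ in Filter.atTop, 𝒟.toSpacetime.truncDeviationCk (boostedKerrBackground Λ c M a) Ψ 2 R τ = 0) → ¬ ((∀ 𝒟 : VacuumCauchyDevelopment d, 𝒟.IsMaximal → Summit.FinalStateConjecture.HasCompleteNullInfinity 𝒟.toCauchyDevelopment) ∧ (∀ 𝒟 : VacuumCauchyDevelopment d, 𝒟.IsMaximal → (∀ (Λ : lorentzGroup) (c : E4) (M a : ℝ), Kerr.IsExtremal M a → ¬ ∃ (τ₀ : ℝ) (Ψ : (boostedKerrBackground Λ c M a).domain → 𝒟.carrier), 𝒟.toSpacetime.IsLateChart (boostedKerrBackground Λ c M a) Set.univ τ₀ Ψ ∧ (∀ ρ : ℝ, ∀ᶠ τ in Filter.atTop, ∀ x ∈ (boostedKerrBackground Λ c M a).truncTimeSlab ρ τ, 𝒟.timeOrientation.IsFutureDirected (mfderiv 𝓘(ℝ, E4) (𝓡 4) Ψ x ((Λ : E4 ≃L[ℝ]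 E4) (Kerr.timeVector M a (poincareInv Λ c (x : E4)))))) ∧ Filter.Tendsto (fun τ => 𝒟.toSpacetime.truncDeviationCk (boostedKerrBackground Λ c M a) Ψ 2 (3 * M + 1) τ) Filter.atTop (nhds 0)))) → RobustlyEscapable d (fun D : InitialDataSet (𝓡 3) X => (∀ 𝒟 : VacuumCauchyDevelopment D, 𝒟.IsMaximal → (∀ (Λ : lorentzGroup) (c : E4) (M a : ℝ), Kerr.IsExtremal M a → ¬ ∃ (τ₀ : ℝ) (Ψ : (boostedKerrBackground Λ c M a).domain → 𝒟.carrier), 𝒟.toSpacetime.IsLateChart (boostedKerrBackground Λ c M a) Set.univ τ₀ Ψ ∧ (∀ ρ : ℝ, ∀ᶠ τ in Filter.atTop, ∀ x ∈ (boostedKerrBackground Λ c M a).truncTimeSlab ρ τ, 𝒟.timeOrientation.IsFutureDirected (mfderiv 𝓘(ℝ, E4) (𝓡 4) Ψ x ((Λ : E4 ≃L[ℝ] E4) (Kerr.timeVector M a (poincareInv Λ c (x : E4)))))) ∧ Filter.Tendsto (fun τ => 𝒟.toSpacetime.truncDeviationCk (boostedKerrBackground Λ c M a) Ψ 2 (3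 * M + 1) τ) Filter.atTop (nhds 0)))) := by
  sorry

/-! ## §2 Linear algebra of the seed certificate (proved): off finitely many proper subspaces is open dense -/

section Seed

variable {E : Type*} [NormedAddCommGroup E] [NormedSpace ℝ E]

/-- The complement of a PROPER linear subspace of a real normed space is dense: approach `v ∈ V` by
`v + w/(n+1)` with `w ∉ V`. (The `κ = 0` replacement of `dense_setOf_apply_ne_zero`: the bad set of a
positive quadratic seed is its kernel.) [folklore] -/
theorem dense_compl_of_ne_top (V : Submodule ℝ E) (hV : V ≠ ⊤) : Dense ((V : Set E)ᶜ) := by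
  have hnot : ¬ ∀ w : E, w ∈ V := fun h => hV (Submodule.eq_top_iff'.2 h)
  obtain ⟨w, hw⟩ := not_forall.1 hnot
  intro v
  by_cases hv : v ∈ (V : Set E)
  swap
  · exact subset_closure hv
  have htend : Tendsto (fun n : ℕ => v + (1 / ((n : ℝ) + 1)) • w) atTop (𝓝 v) := by
    have h1 : Tendsto (fun n : ℕ => (1 / ((n : ℝ) + 1)) • w) atTop (𝓝 ((0 : ℝ) • w)) :=
      tendsto_one_div_add_atTop_nhds_zero_nat.smul_const w
    rw [zero_smul] at h1
    simpa using tendsto_const_nhds.add h1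
  refine mem_closure_of_tendsto htend (Eventually.of_forall fun n => ?_)
  show v + (1 / ((n : ℝ) + 1)) • w ∉ (V : Set E)
  intro hmem
  have hc : (1 / ((n : ℝ) + 1)) ≠ 0 := one_div_ne_zero (Nat.cast_add_one_ne_zero n)
  have hsub : v + (1 / ((n : ℝ) + 1)) • w - v ∈ V := V.sub_mem hmem hv
  rw [add_sub_cancel_left] at hsub
  exact hw ((V.smul_mem_iff hc).1 hsub)

/-- Off FINITELY MANY proper linear subspaces of a finite-dimensional real normed space is an OPEN DENSE set
of directions (subspaces are closed; finite intersection of open dense sets). [folklore] -/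
theorem isOpen_dense_compl_iUnion [FiniteDimensional ℝ E] {J : ℕ} (V : Fin J → Submodule ℝ E)
    (hV : ∀ j, V j ≠ ⊤) :
    IsOpen {v : E | ∀ j, v ∉ V j} ∧ Dense {v : E | ∀ j, v ∉ V j} := by
  have hset : {v : E | ∀ j, v ∉ V j} = ⋂ j, ((V j : Set E)ᶜ) := by
    ext v
    simp only [mem_setOf_eq, mem_iInter, mem_compl_iff, SetLike.mem_coe]
  have hUo : ∀ j, IsOpen ((V j : Set E)ᶜ) := fun j =>
    (Submodule.closed_of_finiteDimensional (V j)).isOpen_compl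
  have hUd : ∀ j, Dense ((V j : Set E)ᶜ) := fun j => dense_compl_of_ne_top (V j) (hV j)
  haveI : CompleteSpace E := FiniteDimensional.complete ℝ E
  rw [hset]
  exact ⟨isOpen_iInter_of_finite hUo, dense_iInter_of_isOpen hUo hUd⟩

end Seed

section Robust

variable {X : Type} [TopologicalSpace X] [ChartedSpace E3 X] [IsManifold (𝓡 3) ((⊤ : ℕ∞) : WithTop ℕ∞) X]

/-- **SEEDED ⇒ ROBUSTLY ESCAPABLE** (the `κ = 0` counterpart of the landed
`robustlyEscapable_of_walls`): if every tame probe through `d` enriches so that along every further tame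
enrichment the bad directions lie in finitely many PROPER linear subspaces (off which the members
`G₂ (t • v)` are good for all small `t ≠ 0`), then `Q` is robustly escapable at `d` — the open dense direction
set is the complement of the subspaces (`isOpen_dense_compl_iUnion`). No regularity of the exceptional set,
no isolatedness of thresholds along a curve, no `C¹` phase portrait is used. [folklore] -/
theorem robustlyEscapable_of_seeded {d : InitialDataSet (𝓡 3) X} {Q : InitialDataSet (𝓡 3) X → Prop}
    (h : ∀ (m : ℕ) (G : EuclideanSpace ℝ (Fin m) → InitialDataSet (𝓡 3) X), Tame d m G →
      ∃ (n : ℕ) (G₁ : EuclideanSpace ℝ (Fin n) → InitialDataSet (𝓡 3) X)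
        (L : EuclideanSpace ℝ (Fin m) →ₗ[ℝ] EuclideanSpace ℝ (Fin n)),
        Function.Injective L ∧ Tame d n G₁ ∧ (∀ c, G₁ (L c) = G c) ∧
        ∀ (p : ℕ) (G₂ : EuclideanSpace ℝ (Fin p) → InitialDataSet (𝓡 3) X)
          (L' : EuclideanSpace ℝ (Fin n) →ₗ[ℝ] EuclideanSpace ℝ (Fin p)),
          Function.Injective L' → Tame d p G₂ → (∀ c, G₂ (L' c) = G₁ c) →
          ∃ (J : ℕ) (V : Fin J → Submodule ℝ (EuclideanSpace ℝ (Fin p))), (∀ j, V j ≠ ⊤) ∧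
            ∀ v : EuclideanSpace ℝ (Fin p), (∀ j, v ∉ V j) →
              ∃ δ : ℝ, 0 < δ ∧ ∀ t : ℝ, t ≠ 0 → |t| < δ → Q (G₂ (t • v))) :
    RobustlyEscapable d Q := by
  intro m G hG
  obtain ⟨n, G₁, L, hL, hT, hGL, H⟩ := h m G hG
  refine ⟨n, G₁, L, hL, hT, hGL, fun p G₂ L' hL' hT₂ hGL' => ?_⟩
  obtain ⟨J, V, hV, hgood⟩ := H p G₂ L' hL' hT₂ hGL'
  obtain ⟨hUo, hUd⟩ := isOpen_dense_compl_iUnion V hV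
  exact ⟨{v | ∀ j, v ∉ V j}, hUo, hUd, fun v hv => hgood v hv⟩

end Robust

/-! ## §3 Gauge invariance of the restated property (proved, from the landed transfer principle) -/

/-- **The property of the restated crux is invariant under re-indexing the datum by a diffeomorphism of
`Σ`** (`D ↦ Φ^* D`): complete `𝓘⁺` transfers along `VacuumCauchyDevelopment.precomp`
(`hasCompleteFutureNullInfinity_precomp_iff`), and the windowed collar clause reads the spacetime, its
metric and time orientation only, which `precomp` keeps definitionally (`Iff.rfl`); maximal developments of
`Φ^* D` and of `D` correspond (`forall_isMaximal_comap_iff`). [folklore] -/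
theorem marginW_comap :
    ∀ (X : Type) [TopologicalSpace X] [ChartedSpace E3 X] [IsManifold (𝓡 3) ((⊤ : ℕ∞) : WithTop ℕ∞) X]
      [T2Space X] [SecondCountableTopology X] [ConnectedSpace X]
      (D : InitialDataSet (𝓡 3) X) (Φ : X ≃ₜ X) (hΦ : ContMDiff (𝓡 3) (𝓡 3) (∞ + 1) Φ)
      (hΦ' : ∀ u, Injective (mfderiv (𝓡 3) (𝓡 3) Φ u)),
      ContMDiff (𝓡 3) (𝓡 3) (∞ + 1) Φ.symm → (∀ u, Injective (mfderiv (𝓡 3) (𝓡 3) Φ.symm u)) →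
      D ∈ admissibleVacuumData X → (fun D : InitialDataSet (𝓡 3) X => ∀ 𝒟 : VacuumCauchyDevelopment D, 𝒟.IsMaximal → Summit.FinalStateConjecture.HasCompleteNullInfinity 𝒟.toCauchyDevelopment ∧ (∀ m₀ ρ₀ : ℝ, 0 < m₀ → 0 < ρ₀ → ∃ (χ₁ : ℝ) (δ₁ : ENNReal) (K₁ : Set 𝒟.carrier), χ₁ < 1 ∧ 0 < δ₁ ∧ IsCompact K₁ ∧ ∀ (M₁ a₁ : ℝ) (mo₁ : lorentzGroup × E4) (B₁ : ModelBackground) (Φ₁ : B₁.domain → 𝒟.carrier), m₀ ≤ M₁ → M₁ ≤ m₀⁻¹ → max ‖((mo₁.1 : E4 ≃L[ℝ] E4) : E4 →L[ℝ] E4)‖ ‖((mo₁.1 : E4 ≃L[ℝ] E4).symm : E4 →L[ℝ] E4)‖ ≤ ρ₀ → |a₁| ≤ M₁ → B₁ = starBackground mo₁.1 mo₁.2 M₁ a₁ (fun x => Kerr.radius a₁ (poincareInv mo₁.1 mo₁.2 x)) → ContMDiffOn 𝓘(ℝ, E4) (𝓡 4) ((⊤ : ℕ∞) : WithTop ℕ∞)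 Φ₁ {x | -1 < B₁.time x.1 ∧ B₁.time x.1 < 1 ∧ B₁.radius x.1 < 3 * M₁ + 1} → Topology.IsOpenEmbedding ({x | -1 < B₁.time x.1 ∧ B₁.time x.1 < 1 ∧ B₁.radius x.1 < 3 * M₁ + 1}.restrict Φ₁) → 𝒟.toSpacetime.truncDeviationCk B₁ Φ₁ 2 (3 * M₁) 0 ≤ δ₁ → Disjoint (Φ₁ '' B₁.truncTimeSlab (3 * M₁) 0) (𝒟.metric.causalPast 𝒟.timeOrientation K₁) → |a₁| ≤ χ₁ * M₁)) D → (fun D : InitialDataSet (𝓡 3) X => ∀ 𝒟 : VacuumCauchyDevelopment D, 𝒟.IsMaximal → Summit.FinalStateConjecture.HasCompleteNullInfinity 𝒟.toCauchyDevelopment ∧ (∀ m₀ ρ₀ : ℝ, 0 < m₀ → 0 < ρ₀ → ∃ (χ₁ : ℝ) (δ₁ : ENNReal) (K₁ : Set 𝒟.carrier), χ₁ < 1 ∧ 0 < δ₁ ∧ IsCompact K₁ ∧ ∀ (M₁ a₁ : ℝ) (mo₁ : lorentzGroup × E4) (B₁ : ModelBackground) (Φ₁ : B₁.domain → 𝒟.carrier),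 m₀ ≤ M₁ → M₁ ≤ m₀⁻¹ → max ‖((mo₁.1 : E4 ≃L[ℝ] E4) : E4 →L[ℝ] E4)‖ ‖((mo₁.1 : E4 ≃L[ℝ] E4).symm : E4 →L[ℝ] E4)‖ ≤ ρ₀ → |a₁| ≤ M₁ → B₁ = starBackground mo₁.1 mo₁.2 M₁ a₁ (fun x => Kerr.radius a₁ (poincareInv mo₁.1 mo₁.2 x)) → ContMDiffOn 𝓘(ℝ, E4) (𝓡 4) ((⊤ : ℕ∞) : WithTop ℕ∞) Φ₁ {x | -1 < B₁.time x.1 ∧ B₁.time x.1 < 1 ∧ B₁.radius x.1 < 3 * M₁ + 1} → Topology.IsOpenEmbedding ({x | -1 < B₁.time x.1 ∧ B₁.time x.1 < 1 ∧ B₁.radius x.1 < 3 * M₁ + 1}.restrict Φ₁) → 𝒟.toSpacetime.truncDeviationCk B₁ Φ₁ 2 (3 * M₁) 0 ≤ δ₁ → Disjoint (Φ₁ '' B₁.truncTimeSlab (3 * M₁) 0) (𝒟.metric.causalPast 𝒟.timeOrientation K₁) → |a₁| ≤ χ₁ * M₁)) (D.comap Φ hΦ hΦ') := by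
  intro X _ _ _ _ _ _ D Φ hΦ hΦ' hΨ hΨ' _ hP
  exact (VacuumCauchyDevelopment.forall_isMaximal_comap_iff Φ hΦ hΦ' hΨ hΨ'
    (fun {D'} 𝒟 => Summit.FinalStateConjecture.HasCompleteNullInfinity 𝒟.toCauchyDevelopment ∧ (∀ m₀ ρ₀ : ℝ, 0 < m₀ → 0 < ρ₀ → ∃ (χ₁ : ℝ) (δ₁ : ENNReal) (K₁ : Set 𝒟.carrier), χ₁ < 1 ∧ 0 < δ₁ ∧ IsCompact K₁ ∧ ∀ (M₁ a₁ : ℝ) (mo₁ : lorentzGroup × E4) (B₁ : ModelBackground) (Φ₁ : B₁.domain → 𝒟.carrier), m₀ ≤ M₁ → M₁ ≤ m₀⁻¹ → max ‖((mo₁.1 : E4 ≃L[ℝ] E4) : E4 →L[ℝ] E4)‖ ‖((mo₁.1 : E4 ≃L[ℝ] E4).symm : E4 →L[ℝ] E4)‖ ≤ ρ₀ → |a₁| ≤ M₁ → B₁ = starBackground mo₁.1 mo₁.2 M₁ a₁ (fun x => Kerr.radius a₁ (poincareInv mo₁.1 mo₁.2 x)) → ContMDiffOn 𝓘(ℝ,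 E4) (𝓡 4) ((⊤ : ℕ∞) : WithTop ℕ∞) Φ₁ {x | -1 < B₁.time x.1 ∧ B₁.time x.1 < 1 ∧ B₁.radius x.1 < 3 * M₁ + 1} → Topology.IsOpenEmbedding ({x | -1 < B₁.time x.1 ∧ B₁.time x.1 < 1 ∧ B₁.radius x.1 < 3 * M₁ + 1}.restrict Φ₁) → 𝒟.toSpacetime.truncDeviationCk B₁ Φ₁ 2 (3 * M₁) 0 ≤ δ₁ → Disjoint (Φ₁ '' B₁.truncTimeSlab (3 * M₁) 0) (𝒟.metric.causalPast 𝒟.timeOrientation K₁) → |a₁| ≤ χ₁ * M₁))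
    (fun 𝒟 Θ hΘ hΘ' => and_congr (𝒟.hasCompleteFutureNullInfinity_precomp_iff Θ hΘ hΘ') Iff.rfl)).2 hP

/-! ## §4 The composition (sorry-free): stubs A, C, D, E_good, E_bad ⟹ the restated crux, BY NAME -/

/-- **The five stub SIGNATURES imply `TameCensorshipCollarMarginW`.** Per `X`: the engine
`isTameChristodoulouGeneric_of_robust` (landed, `Theorems/PhotonSphereChannelsTameCensorshipOfRobustKernels.lean`)
with `Q D :=` "every MGHD censored ∧ every MGHD free of future-going asymptotically-extremal collar-zone late
charts" and `P :=` the restated property; gauge invariance of `P` is `marginW_comap`; `Q ⇒ P` on admissible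
data is the census `stub_collarCensus` per MGHD; `Q` is robustly escapable at every admissible `d` by
`RobustlyEscapable.and` of `stub_censorshipRobust` with the freeness half, which is `stub_openAtGood` at good
data, `robustlyEscapable_of_seeded ∘ stub_kuSeed` at Kehle–Unger data and `stub_thresholdOffKU` at the
remaining exceptional data (exhaustive case split, `Classical`). [folklore] -/
theorem TameCensorshipCollarMarginW_of_stubs
    (hA : ∀ (X : Type) [TopologicalSpace X] [ChartedSpace E3 X] [IsManifold (𝓡 3) ((⊤ : ℕ∞) : WithTop ℕ∞) X] [T2Space X] [SecondCountableTopology X] [ConnectedSpace X], ∀ d ∈ admissibleVacuumData X, RobustlyEscapable d (fun D : InitialDataSet (𝓡 3) X => (∀ 𝒟 : VacuumCauchyDevelopment D, 𝒟.IsMaximal → Summit.FinalStateConjecture.HasCompleteNullInfinity 𝒟.toCauchyDevelopment)))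
    (hC : ∀ (X : Type) [TopologicalSpace X] [ChartedSpace E3 X] [IsManifold (𝓡 3) ((⊤ : ℕ∞) : WithTop ℕ∞) X] [T2Space X] [SecondCountableTopology X] [ConnectedSpace X], ∀ D ∈ admissibleVacuumData X, ∀ 𝒟 : VacuumCauchyDevelopment D, 𝒟.IsMaximal → Summit.FinalStateConjecture.HasCompleteNullInfinity 𝒟.toCauchyDevelopment → (∀ (Λ : lorentzGroup) (c : E4) (M a : ℝ), Kerr.IsExtremal M a → ¬ ∃ (τ₀ : ℝ) (Ψ : (boostedKerrBackground Λ c M a).domain → 𝒟.carrier), 𝒟.toSpacetime.IsLateChart (boostedKerrBackground Λ c M a) Set.univ τ₀ Ψ ∧ (∀ ρ : ℝ, ∀ᶠ τ in Filter.atTop, ∀ x ∈ (boostedKerrBackground Λ c M a).truncTimeSlab ρ τ, 𝒟.timeOrientation.IsFutureDirected (mfderiv 𝓘(ℝ, E4) (𝓡 4) Ψ x ((Λ : E4 ≃L[ℝ] E4) (Kerr.timeVector M a (poincareInv Λ c (x : E4)))))) ∧ Filter.Tendsto (fun τ => 𝒟.toSpacetime.truncDeviationCk (boostedKerrBackground Λ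 c M a) Ψ 2 (3 * M + 1) τ) Filter.atTop (nhds 0)) → (∀ m₀ ρ₀ : ℝ, 0 < m₀ → 0 < ρ₀ → ∃ (χ₁ : ℝ) (δ₁ : ENNReal) (K₁ : Set 𝒟.carrier), χ₁ < 1 ∧ 0 < δ₁ ∧ IsCompact K₁ ∧ ∀ (M₁ a₁ : ℝ) (mo₁ : lorentzGroup × E4) (B₁ : ModelBackground) (Φ₁ : B₁.domain → 𝒟.carrier), m₀ ≤ M₁ → M₁ ≤ m₀⁻¹ → max ‖((mo₁.1 : E4 ≃L[ℝ] E4) : E4 →L[ℝ] E4)‖ ‖((mo₁.1 : E4 ≃L[ℝ] E4).symm : E4 →L[ℝ] E4)‖ ≤ ρ₀ → |a₁| ≤ M₁ → B₁ = starBackground mo₁.1 mo₁.2 M₁ a₁ (fun x => Kerr.radius a₁ (poincareInv mo₁.1 mo₁.2 x)) → ContMDiffOn 𝓘(ℝ, E4) (𝓡 4) ((⊤ : ℕ∞) : WithTop ℕ∞) Φ₁ {x | -1 < B₁.time x.1 ∧ B₁.time x.1 < 1 ∧ B₁.radius x.1 < 3 * M₁ + 1} → Topology.IsOpenEmbedding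 ({x | -1 < B₁.time x.1 ∧ B₁.time x.1 < 1 ∧ B₁.radius x.1 < 3 * M₁ + 1}.restrict Φ₁) → 𝒟.toSpacetime.truncDeviationCk B₁ Φ₁ 2 (3 * M₁) 0 ≤ δ₁ → Disjoint (Φ₁ '' B₁.truncTimeSlab (3 * M₁) 0) (𝒟.metric.causalPast 𝒟.timeOrientation K₁) → |a₁| ≤ χ₁ * M₁))
    (hD : ∀ (X : Type) [TopologicalSpace X] [ChartedSpace E3 X] [IsManifold (𝓡 3) ((⊤ : ℕ∞) : WithTop ℕ∞) X] [T2Space X] [SecondCountableTopology X] [ConnectedSpace X], ∀ d ∈ admissibleVacuumData X, (∃ 𝒟 : VacuumCauchyDevelopment d, 𝒟.IsMaximal ∧ Summit.FinalStateConjecture.HasCompleteNullInfinity 𝒟.toCauchyDevelopment ∧ ∃ (Λ : lorentzGroup) (c : E4) (M a : ℝ) (τ₀ : ℝ) (Ψ : (boostedKerrBackground Λ c M a).domain → 𝒟.carrier), Kerr.IsExtremal M a ∧ 𝒟.toSpacetime.IsLateChart (boostedKerrBackground Λ c M a) Set.univ τ₀ Ψ ∧ (∀ ρ : ℝ, ∀ᶠ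 τ in Filter.atTop, ∀ x ∈ (boostedKerrBackground Λ c M a).truncTimeSlab ρ τ, 𝒟.timeOrientation.IsFutureDirected (mfderiv 𝓘(ℝ, E4) (𝓡 4) Ψ x ((Λ : E4 ≃L[ℝ] E4) (Kerr.timeVector M a (poincareInv Λ c (x : E4)))))) ∧ ∀ R : ℝ, ∀ᶠ τ in Filter.atTop, 𝒟.toSpacetime.truncDeviationCk (boostedKerrBackground Λ c M a) Ψ 2 R τ = 0) → ∀ (m : ℕ) (G : EuclideanSpace ℝ (Fin m) → InitialDataSet (𝓡 3) X), Tame d m G → ∃ (n : ℕ) (G₁ : EuclideanSpace ℝ (Fin n) → InitialDataSet (𝓡 3) X) (L : EuclideanSpace ℝ (Fin m) →ₗ[ℝ] EuclideanSpace ℝ (Fin n)), Function.Injective L ∧ Tame d n G₁ ∧ (∀ c, G₁ (L c) = G c) ∧ ∀ (p : ℕ) (G₂ : EuclideanSpace ℝ (Fin p) → InitialDataSet (𝓡 3) X) (L' : EuclideanSpace ℝ (Fin n) →ₗ[ℝ] EuclideanSpace ℝ (Fin p)), Function.Injective L' → Tame d p G₂ → (∀ c, G₂ (L' c) = G₁ c)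 → ∃ (J : ℕ) (V : Fin J → Submodule ℝ (EuclideanSpace ℝ (Fin p))), (∀ j, V j ≠ ⊤) ∧ ∀ v : EuclideanSpace ℝ (Fin p), (∀ j, v ∉ V j) → ∃ δ : ℝ, 0 < δ ∧ ∀ t : ℝ, t ≠ 0 → |t| < δ → (∀ 𝒟 : VacuumCauchyDevelopment (G₂ (t • v)), 𝒟.IsMaximal → (∀ (Λ : lorentzGroup) (c : E4) (M a : ℝ), Kerr.IsExtremal M a → ¬ ∃ (τ₀ : ℝ) (Ψ : (boostedKerrBackground Λ c M a).domain → 𝒟.carrier), 𝒟.toSpacetime.IsLateChart (boostedKerrBackground Λ c M a) Set.univ τ₀ Ψ ∧ (∀ ρ : ℝ, ∀ᶠ τ in Filter.atTop, ∀ x ∈ (boostedKerrBackground Λ c M a).truncTimeSlab ρ τ, 𝒟.timeOrientation.IsFutureDirected (mfderiv 𝓘(ℝ, E4) (𝓡 4) Ψ x ((Λ : E4 ≃L[ℝ] E4) (Kerr.timeVector M a (poincareInv Λ c (x : E4)))))) ∧ Filter.Tendsto (fun τ => 𝒟.toSpacetime.truncDeviationCk (boostedKerrBackground Λ c M a) Ψ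 2 (3 * M + 1) τ) Filter.atTop (nhds 0))))
    (hEg : ∀ (X : Type) [TopologicalSpace X] [ChartedSpace E3 X] [IsManifold (𝓡 3) ((⊤ : ℕ∞) : WithTop ℕ∞) X] [T2Space X] [SecondCountableTopology X] [ConnectedSpace X], ∀ d ∈ admissibleVacuumData X, (∀ 𝒟 : VacuumCauchyDevelopment d, 𝒟.IsMaximal → Summit.FinalStateConjecture.HasCompleteNullInfinity 𝒟.toCauchyDevelopment) → (∀ 𝒟 : VacuumCauchyDevelopment d, 𝒟.IsMaximal → (∀ (Λ : lorentzGroup) (c : E4) (M a : ℝ), Kerr.IsExtremal M a → ¬ ∃ (τ₀ : ℝ) (Ψ : (boostedKerrBackground Λ c M a).domain → 𝒟.carrier), 𝒟.toSpacetime.IsLateChart (boostedKerrBackground Λ c M a) Set.univ τ₀ Ψ ∧ (∀ ρ : ℝ, ∀ᶠ τ in Filter.atTop, ∀ x ∈ (boostedKerrBackground Λ c M a).truncTimeSlab ρ τ, 𝒟.timeOrientation.IsFutureDirected (mfderiv 𝓘(ℝ, E4) (𝓡 4) Ψ x ((Λ : E4 ≃L[ℝ] E4) (Kerr.timeVector M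 a (poincareInv Λ c (x : E4)))))) ∧ Filter.Tendsto (fun τ => 𝒟.toSpacetime.truncDeviationCk (boostedKerrBackground Λ c M a) Ψ 2 (3 * M + 1) τ) Filter.atTop (nhds 0))) → RobustlyEscapable d (fun D : InitialDataSet (𝓡 3) X => (∀ 𝒟 : VacuumCauchyDevelopment D, 𝒟.IsMaximal → (∀ (Λ : lorentzGroup) (c : E4) (M a : ℝ), Kerr.IsExtremal M a → ¬ ∃ (τ₀ : ℝ) (Ψ : (boostedKerrBackground Λ c M a).domain → 𝒟.carrier), 𝒟.toSpacetime.IsLateChart (boostedKerrBackground Λ c M a) Set.univ τ₀ Ψ ∧ (∀ ρ : ℝ, ∀ᶠ τ in Filter.atTop, ∀ x ∈ (boostedKerrBackground Λ c M a).truncTimeSlab ρ τ, 𝒟.timeOrientation.IsFutureDirected (mfderiv 𝓘(ℝ, E4) (𝓡 4) Ψ x ((Λ : E4 ≃L[ℝ] E4) (Kerr.timeVector M a (poincareInv Λ c (x : E4)))))) ∧ Filter.Tendsto (fun τ => 𝒟.toSpacetime.truncDeviationCk (boostedKerrBackground Λ c M a) Ψ 2 (3 * M + 1) τ) Filter.atTop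 (nhds 0)))))
    (hEb : ∀ (X : Type) [TopologicalSpace X] [ChartedSpace E3 X] [IsManifold (𝓡 3) ((⊤ : ℕ∞) : WithTop ℕ∞) X] [T2Space X] [SecondCountableTopology X] [ConnectedSpace X], ∀ d ∈ admissibleVacuumData X, ¬ (∃ 𝒟 : VacuumCauchyDevelopment d, 𝒟.IsMaximal ∧ Summit.FinalStateConjecture.HasCompleteNullInfinity 𝒟.toCauchyDevelopment ∧ ∃ (Λ : lorentzGroup) (c : E4) (M a : ℝ) (τ₀ : ℝ) (Ψ : (boostedKerrBackground Λ c M a).domain → 𝒟.carrier), Kerr.IsExtremal M a ∧ 𝒟.toSpacetime.IsLateChart (boostedKerrBackground Λ c M a) Set.univ τ₀ Ψ ∧ (∀ ρ : ℝ, ∀ᶠ τ in Filter.atTop, ∀ x ∈ (boostedKerrBackground Λ c M a).truncTimeSlab ρ τ, 𝒟.timeOrientation.IsFutureDirected (mfderiv 𝓘(ℝ, E4) (𝓡 4) Ψ x ((Λ : E4 ≃L[ℝ] E4) (Kerr.timeVector M a (poincareInv Λ c (x : E4)))))) ∧ ∀ R : ℝ, ∀ᶠ τ in Filter.atTop, 𝒟.toSpacetime.truncDeviationCk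 (boostedKerrBackground Λ c M a) Ψ 2 R τ = 0) → ¬ ((∀ 𝒟 : VacuumCauchyDevelopment d, 𝒟.IsMaximal → Summit.FinalStateConjecture.HasCompleteNullInfinity 𝒟.toCauchyDevelopment) ∧ (∀ 𝒟 : VacuumCauchyDevelopment d, 𝒟.IsMaximal → (∀ (Λ : lorentzGroup) (c : E4) (M a : ℝ), Kerr.IsExtremal M a → ¬ ∃ (τ₀ : ℝ) (Ψ : (boostedKerrBackground Λ c M a).domain → 𝒟.carrier), 𝒟.toSpacetime.IsLateChart (boostedKerrBackground Λ c M a) Set.univ τ₀ Ψ ∧ (∀ ρ : ℝ, ∀ᶠ τ in Filter.atTop, ∀ x ∈ (boostedKerrBackground Λ c M a).truncTimeSlab ρ τ, 𝒟.timeOrientation.IsFutureDirected (mfderiv 𝓘(ℝ, E4) (𝓡 4) Ψ x ((Λ : E4 ≃L[ℝ] E4) (Kerr.timeVector M a (poincareInv Λ c (x : E4)))))) ∧ Filter.Tendsto (fun τ => 𝒟.toSpacetime.truncDeviationCk (boostedKerrBackground Λ c M a) Ψ 2 (3 * M + 1) τ) Filter.atTop (nhds 0)))) → RobustlyEscapable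 d (fun D : InitialDataSet (𝓡 3) X => (∀ 𝒟 : VacuumCauchyDevelopment D, 𝒟.IsMaximal → (∀ (Λ : lorentzGroup) (c : E4) (M a : ℝ), Kerr.IsExtremal M a → ¬ ∃ (τ₀ : ℝ) (Ψ : (boostedKerrBackground Λ c M a).domain → 𝒟.carrier), 𝒟.toSpacetime.IsLateChart (boostedKerrBackground Λ c M a) Set.univ τ₀ Ψ ∧ (∀ ρ : ℝ, ∀ᶠ τ in Filter.atTop, ∀ x ∈ (boostedKerrBackground Λ c M a).truncTimeSlab ρ τ, 𝒟.timeOrientation.IsFutureDirected (mfderiv 𝓘(ℝ, E4) (𝓡 4) Ψ x ((Λ : E4 ≃L[ℝ] E4) (Kerr.timeVector M a (poincareInv Λ c (x : E4)))))) ∧ Filter.Tendsto (fun τ => 𝒟.toSpacetime.truncDeviationCk (boostedKerrBackground Λ c M a) Ψ 2 (3 * M + 1) τ) Filter.atTop (nhds 0))))) :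
    TameCensorshipCollarMarginW := by
  intro X _ _ _ _ _ _
  -- the freeness half is robustly escapable at every admissible datum (three mechanisms, exhaustive)
  have hfree : ∀ d ∈ admissibleVacuumData X, RobustlyEscapable d (fun D : InitialDataSet (𝓡 3) X => (∀ 𝒟 : VacuumCauchyDevelopment D, 𝒟.IsMaximal → (∀ (Λ : lorentzGroup) (c : E4) (M a : ℝ), Kerr.IsExtremal M a → ¬ ∃ (τ₀ : ℝ) (Ψ : (boostedKerrBackground Λ c M a).domain → 𝒟.carrier), 𝒟.toSpacetime.IsLateChart (boostedKerrBackground Λ c M a) Set.univ τ₀ Ψ ∧ (∀ ρ : ℝ, ∀ᶠ τ in Filter.atTop, ∀ x ∈ (boostedKerrBackground Λ c M a).truncTimeSlab ρ τ, 𝒟.timeOrientation.IsFutureDirected (mfderiv 𝓘(ℝ, E4) (𝓡 4) Ψ x ((Λ : E4 ≃L[ℝ] E4) (Kerr.timeVector M a (poincareInv Λ c (x : E4)))))) ∧ Filter.Tendsto (fun τ => 𝒟.toSpacetime.truncDeviationCk (boostedKerrBackground Λ c M a) Ψ 2 (3 * M + 1) τ) Filter.atTop (nhds 0)))) := by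
    intro d hd
    by_cases hgood : (∀ 𝒟 : VacuumCauchyDevelopment d, 𝒟.IsMaximal → Summit.FinalStateConjecture.HasCompleteNullInfinity 𝒟.toCauchyDevelopment) ∧ (∀ 𝒟 : VacuumCauchyDevelopment d, 𝒟.IsMaximal → (∀ (Λ : lorentzGroup) (c : E4) (M a : ℝ), Kerr.IsExtremal M a → ¬ ∃ (τ₀ : ℝ) (Ψ : (boostedKerrBackground Λ c M a).domain → 𝒟.carrier), 𝒟.toSpacetime.IsLateChart (boostedKerrBackground Λ c M a) Set.univ τ₀ Ψ ∧ (∀ ρ : ℝ, ∀ᶠ τ in Filter.atTop, ∀ x ∈ (boostedKerrBackground Λ c M a).truncTimeSlab ρ τ, 𝒟.timeOrientation.IsFutureDirected (mfderiv 𝓘(ℝ, E4) (𝓡 4) Ψ x ((Λ : E4 ≃L[ℝ] E4) (Kerr.timeVector M a (poincareInv Λ c (x : E4)))))) ∧ Filter.Tendsto (fun τ => 𝒟.toSpacetime.truncDeviationCk (boostedKerrBackground Λ c M a) Ψ 2 (3 * M + 1) τ) Filter.atTop (nhds 0)))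
    · exact hEg X d hd hgood.1 hgood.2
    · by_cases hKU : (∃ 𝒟 : VacuumCauchyDevelopment d, 𝒟.IsMaximal ∧ Summit.FinalStateConjecture.HasCompleteNullInfinity 𝒟.toCauchyDevelopment ∧ ∃ (Λ : lorentzGroup) (c : E4) (M a : ℝ) (τ₀ : ℝ) (Ψ : (boostedKerrBackground Λ c M a).domain → 𝒟.carrier), Kerr.IsExtremal M a ∧ 𝒟.toSpacetime.IsLateChart (boostedKerrBackground Λ c M a) Set.univ τ₀ Ψ ∧ (∀ ρ : ℝ, ∀ᶠ τ in Filter.atTop, ∀ x ∈ (boostedKerrBackground Λ c M a).truncTimeSlab ρ τ, 𝒟.timeOrientation.IsFutureDirected (mfderiv 𝓘(ℝ, E4) (𝓡 4) Ψ x ((Λ : E4 ≃L[ℝ] E4) (Kerr.timeVector M a (poincareInv Λ c (x : E4)))))) ∧ ∀ R : ℝ, ∀ᶠ τ in Filter.atTop, 𝒟.toSpacetime.truncDeviationCk (boostedKerrBackground Λ c M a) Ψ 2 R τ = 0)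
      · exact robustlyEscapable_of_seeded (hD X d hd hKU)
      · exact hEb X d hd hKU hgood
  -- conjoin with robust censorship
  have hrob : ∀ d ∈ admissibleVacuumData X, RobustlyEscapable d (fun D : InitialDataSet (𝓡 3) X => (∀ 𝒟 : VacuumCauchyDevelopment D, 𝒟.IsMaximal → Summit.FinalStateConjecture.HasCompleteNullInfinity 𝒟.toCauchyDevelopment) ∧ (∀ 𝒟 : VacuumCauchyDevelopment D, 𝒟.IsMaximal → (∀ (Λ : lorentzGroup) (c : E4) (M a : ℝ), Kerr.IsExtremal M a → ¬ ∃ (τ₀ : ℝ) (Ψ : (boostedKerrBackground Λ c M a).domain → 𝒟.carrier), 𝒟.toSpacetime.IsLateChart (boostedKerrBackground Λ c M a) Set.univ τ₀ Ψ ∧ (∀ ρ : ℝ, ∀ᶠ τ in Filter.atTop, ∀ x ∈ (boostedKerrBackground Λ c M a).truncTimeSlab ρ τ, 𝒟.timeOrientation.IsFutureDirected (mfderiv 𝓘(ℝ, E4) (𝓡 4) Ψ x ((Λ : E4 ≃L[ℝ] E4) (Kerr.timeVector M a (poincareInv Λ c (x : E4)))))) ∧ Filter.Tendsto (fun τ =>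 𝒟.toSpacetime.truncDeviationCk (boostedKerrBackground Λ c M a) Ψ 2 (3 * M + 1) τ) Filter.atTop (nhds 0)))) :=
    fun d hd => (hA X d hd).and (hfree d hd)
  -- the engine
  refine isTameChristodoulouGeneric_of_robust X (fun D : InitialDataSet (𝓡 3) X => (∀ 𝒟 : VacuumCauchyDevelopment D, 𝒟.IsMaximal → Summit.FinalStateConjecture.HasCompleteNullInfinity 𝒟.toCauchyDevelopment) ∧ (∀ 𝒟 : VacuumCauchyDevelopment D, 𝒟.IsMaximal → (∀ (Λ : lorentzGroup) (c : E4) (M a : ℝ), Kerr.IsExtremal M a → ¬ ∃ (τ₀ : ℝ) (Ψ : (boostedKerrBackground Λ c M a).domain → 𝒟.carrier), 𝒟.toSpacetime.IsLateChart (boostedKerrBackground Λ c M a) Set.univ τ₀ Ψ ∧ (∀ ρ : ℝ, ∀ᶠ τ in Filter.atTop, ∀ x ∈ (boostedKerrBackground Λ c M a).truncTimeSlab ρ τ, 𝒟.timeOrientation.IsFutureDirected (mfderiv 𝓘(ℝ, E4) (𝓡 4) Ψ x ((Λ : E4 ≃L[ℝ] E4) (Kerr.timeVector M a (poincareInv Λ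 c (x : E4)))))) ∧ Filter.Tendsto (fun τ => 𝒟.toSpacetime.truncDeviationCk (boostedKerrBackground Λ c M a) Ψ 2 (3 * M + 1) τ) Filter.atTop (nhds 0)))) (fun D : InitialDataSet (𝓡 3) X => ∀ 𝒟 : VacuumCauchyDevelopment D, 𝒟.IsMaximal → Summit.FinalStateConjecture.HasCompleteNullInfinity 𝒟.toCauchyDevelopment ∧ (∀ m₀ ρ₀ : ℝ, 0 < m₀ → 0 < ρ₀ → ∃ (χ₁ : ℝ) (δ₁ : ENNReal) (K₁ : Set 𝒟.carrier), χ₁ < 1 ∧ 0 < δ₁ ∧ IsCompact K₁ ∧ ∀ (M₁ a₁ : ℝ) (mo₁ : lorentzGroup × E4) (B₁ : ModelBackground) (Φ₁ : B₁.domain → 𝒟.carrier), m₀ ≤ M₁ → M₁ ≤ m₀⁻¹ → max ‖((mo₁.1 : E4 ≃L[ℝ] E4) : E4 →L[ℝ] E4)‖ ‖((mo₁.1 : E4 ≃L[ℝ] E4).symm : E4 →L[ℝ] E4)‖ ≤ ρ₀ → |a₁| ≤ M₁ → B₁ = starBackground mo₁.1 mo₁.2 M₁ a₁ (fun x => Kerr.radius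 a₁ (poincareInv mo₁.1 mo₁.2 x)) → ContMDiffOn 𝓘(ℝ, E4) (𝓡 4) ((⊤ : ℕ∞) : WithTop ℕ∞) Φ₁ {x | -1 < B₁.time x.1 ∧ B₁.time x.1 < 1 ∧ B₁.radius x.1 < 3 * M₁ + 1} → Topology.IsOpenEmbedding ({x | -1 < B₁.time x.1 ∧ B₁.time x.1 < 1 ∧ B₁.radius x.1 < 3 * M₁ + 1}.restrict Φ₁) → 𝒟.toSpacetime.truncDeviationCk B₁ Φ₁ 2 (3 * M₁) 0 ≤ δ₁ → Disjoint (Φ₁ '' B₁.truncTimeSlab (3 * M₁) 0) (𝒟.metric.causalPast 𝒟.timeOrientation K₁) → |a₁| ≤ χ₁ * M₁)) (marginW_comap X) ?_ ?_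
  · intro D hD hQ 𝒟 hmax
    exact ⟨hQ.1 𝒟 hmax, hC X D hD 𝒟 hmax (hQ.1 𝒟 hmax) (hQ.2 𝒟 hmax)⟩
  · intro d hd
    exact hrob d hd

/-- **THE SKELETON THEOREM: `TameCensorshipCollarMarginW` (the RESTATED crux, by name) from the five
registered stubs** — `TameCensorshipCollarMarginW_of_stubs` applied to `stub_censorshipRobust`,
`stub_collarCensus`, `stub_kuSeed`, `stub_openAtGood`, `stub_thresholdOffKU` (the only `sorry`s of the file
live inside those five stubs; this term is sorry-free). -/
theorem TameCensorshipCollarMarginW_of : TameCensorshipCollarMarginW :=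
  TameCensorshipCollarMarginW_of_stubs stub_censorshipRobust stub_collarCensus stub_kuSeed
    stub_openAtGood stub_thresholdOffKU

/-! ## §5 For the record: relation to the FILED decl (no stub, no sorry — the transfer is an explicit
hypothesis, and it is DEAD) -/

/-- **Filed decl ⇐ restated decl + the unwindowing transfer (as a HYPOTHESIS).** The filed route decl
`BartnikGapSettling.TameCensorshipCollarMargin` follows from `TameCensorshipCollarMarginW` and the pointwise
unwindowing transfer (= the registered `stub_unwindowing` of `Lines/birth.lean`, verbatim), by
`IsTameChristodoulouGeneric.mono`. The transfer is NOT a stub of this line: it is refuted on one good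
development with junk (`VERDICT_lead0.lean` §1 `stub_unwindowing_false_of_ExtremalJunkCollars`), and the
filed decl itself is false modulo `ExtremalJunkCollars ∧ MGHDExists`
(`Theorems/TameCensorshipCollarMargin/Negative/…FalseOfExtremalJunkCollars.lean`, p146745). Recorded so the
audit sees exactly how (and only how) this line touches the filed text. [folklore] -/
theorem filed_of_unwindowing_of_marginW
    (hU : ∀ (X : Type) [TopologicalSpace X] [ChartedSpace E3 X] [IsManifold (𝓡 3) ((⊤ : ℕ∞) : WithTop ℕ∞) X] [T2Space X] [SecondCountableTopology X] [ConnectedSpace X], ∀ D ∈ admissibleVacuumData X, ∀ 𝒟 : VacuumCauchyDevelopment D, 𝒟.IsMaximal → Summit.FinalStateConjecture.HasCompleteNullInfinity 𝒟.toCauchyDevelopment → (∀ m₀ ρ₀ : ℝ, 0 < m₀ → 0 < ρ₀ → ∃ (χ₁ : ℝ) (δ₁ : ENNReal) (K₁ : Set 𝒟.carrier), χ₁ < 1 ∧ 0 < δ₁ ∧ IsCompact K₁ ∧ ∀ (M₁ a₁ : ℝ) (mo₁ : lorentzGroup × E4) (B₁ : ModelBackground) (Φ₁ : B₁.domain → 𝒟.carrier),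 m₀ ≤ M₁ → M₁ ≤ m₀⁻¹ → max ‖((mo₁.1 : E4 ≃L[ℝ] E4) : E4 →L[ℝ] E4)‖ ‖((mo₁.1 : E4 ≃L[ℝ] E4).symm : E4 →L[ℝ] E4)‖ ≤ ρ₀ → |a₁| ≤ M₁ → B₁ = starBackground mo₁.1 mo₁.2 M₁ a₁ (fun x => Kerr.radius a₁ (poincareInv mo₁.1 mo₁.2 x)) → ContMDiffOn 𝓘(ℝ, E4) (𝓡 4) ((⊤ : ℕ∞) : WithTop ℕ∞) Φ₁ {x | -1 < B₁.time x.1 ∧ B₁.time x.1 < 1 ∧ B₁.radius x.1 < 3 * M₁ + 1} → Topology.IsOpenEmbedding ({x | -1 < B₁.time x.1 ∧ B₁.time x.1 < 1 ∧ B₁.radius x.1 < 3 * M₁ + 1}.restrict Φ₁) → 𝒟.toSpacetime.truncDeviationCk B₁ Φ₁ 2 (3 * M₁) 0 ≤ δ₁ → Disjoint (Φ₁ '' B₁.truncTimeSlab (3 * M₁) 0) (𝒟.metric.causalPast 𝒟.timeOrientation K₁) → |a₁| ≤ χ₁ * M₁) → (∃ (χ₁ : ℝ) (k₁ : ℕ)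 (δ₁ : ENNReal) (K₁ : Set 𝒟.carrier), χ₁ < 1 ∧ 0 < δ₁ ∧ IsCompact K₁ ∧ ∀ (M₁ a₁ : ℝ) (mo₁ : lorentzGroup × E4) (B₁ : ModelBackground) (Φ₁ : B₁.domain → 𝒟.carrier), 0 < M₁ → |a₁| ≤ M₁ → B₁ = starBackground mo₁.1 mo₁.2 M₁ a₁ (fun x => Kerr.radius a₁ (poincareInv mo₁.1 mo₁.2 x)) → ContMDiffOn 𝓘(ℝ, E4) (𝓡 4) ((⊤ : ℕ∞) : WithTop ℕ∞) Φ₁ {x | -1 < B₁.time x.1 ∧ B₁.time x.1 < 1 ∧ B₁.radius x.1 < 3 * M₁ + 1} → Topology.IsOpenEmbedding ({x | -1 < B₁.time x.1 ∧ B₁.time x.1 < 1 ∧ B₁.radius x.1 < 3 * M₁ + 1}.restrict Φ₁) → 𝒟.toSpacetime.truncDeviationCk B₁ Φ₁ k₁ (3 * M₁) 0 ≤ δ₁ → Disjoint (Φ₁ '' B₁.truncTimeSlab (3 * M₁) 0) (𝒟.metric.causalPast 𝒟.timeOrientation K₁) → |a₁| ≤ χ₁ * M₁))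
    (hW : TameCensorshipCollarMarginW) :
    Summit.FinalStateConjecture.FinalStateConjecture.Theses.BartnikGapSettling.TameCensorshipCollarMargin := by
  intro X _ _ _ _ _ _
  refine (hW X).mono ?_
  intro D hD hP 𝒟 hmax
  obtain ⟨hCNI, hMW⟩ := hP 𝒟 hmax
  exact ⟨hCNI, hU X D hD 𝒟 hmax hCNI hMW⟩

/-- **The filed decl is false modulo `ExtremalJunkCollars ∧ MGHDExists`** — re-export of the landed
negative lemma (p146745), so that the record of §5 is complete in one place. -/
theorem filed_false_of_ExtremalJunkCollars :
    Summit.FinalStateConjecture.FinalStateConjecture.Theorems.GenericCensorshipCollarMargin.Negative.ExtremalJunkCollars →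
    Summit.FinalStateConjecture.FinalStateConjecture.Theses.BartnikGapSettling.MGHDExists →
    ¬ Summit.FinalStateConjecture.FinalStateConjecture.Theses.BartnikGapSettling.TameCensorshipCollarMargin :=
  Summit.FinalStateConjecture.FinalStateConjecture.Theorems.TameCensorshipCollarMargin.Negative.TameCensorshipCollarMargin_false_of_ExtremalJunkCollars

end Summit.FinalStateConjecture.FinalStateConjecture.Cruxes.TameCensorshipCollarMargin.KfluxSeedsTheRatchet

end
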